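import Mathlib
import HarnessLib

/-!
# Radial Archimedes (`LambertianContactSwap.LambertianEuler`, stmt-AtomisticToContinuum-11854,
# line `Sketch`; helper file for the stubs `stub_lambertLaw`, `stub_archimedes`)

Under `γ₁(dx) ⊗ r e^{-r²/2} dr` on `ℝ × (0, ∞)` — a standard Gaussian coordinate and the radius of
an independent planar standard Gaussian, i.e. the cylindrical coordinates of a standard Gaussian
vector of `ℝ³` about a fixed axis — the polar cosine `x/√(x² + r²)` is uniform on `[-1, 1]`
(`radialArchimedes`; Archimedes' hat-box theorem). Proof: polar coordinates in the half-plane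
(`lintegral_comp_polarCoord_symm`) separate the radius from the angle `α`, the substitution
`t = cos α` (`lintegral_image_eq_lintegral_abs_deriv_mul`) gives `dt` on `[-1, 1]`, and the
radial constant is read off the total mass (`∫_0^∞ r e^{-r²/2} dr = 1`, FTC on `[0, ∞)`).
All [folklore].
-/

noncomputable section

open MeasureTheory ProbabilityTheory Set Real Filter
open scoped ENNReal

namespace Summit.AtomisticToContinuum.HydrodynamicLimit.Theorems.LambertianContactSwapLambertianEulerRadialArchimedes

/-! ### Radial Archimedes: the polar cosine of `γ₁ ⊗ (r e^{-r²/2} dr)` is uniform -/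

/-- `∫_0^∞ r e^{-r²/2} dr = 1` (`lintegral` form): the radial law of a planar standard Gaussian is a
probability law. [folklore] -/
theorem lintegral_Ioi_mul_exp_neg_sq_half :
    ∫⁻ r in Ioi (0 : ℝ), ENNReal.ofReal (r * rexp (-r ^ 2 / 2)) = 1 := by
  have hderiv : ∀ r ∈ Ici (0 : ℝ),
      HasDerivAt (fun r : ℝ => -rexp (-r ^ 2 / 2)) (r * rexp (-r ^ 2 / 2)) r := by
    intro r _
    have h1 : HasDerivAt (fun r : ℝ => -r ^ 2 / 2) (-(((2 : ℕ) : ℝ) * r ^ (2 - 1)) / 2) r :=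
      ((hasDerivAt_pow 2 r).neg).div_const 2
    have h2 := (h1.exp).neg
    refine h2.congr_deriv ?_
    norm_num
    ring
  have hpos : ∀ r ∈ Ioi (0 : ℝ), 0 ≤ r * rexp (-r ^ 2 / 2) := fun r hr =>
    mul_nonneg (le_of_lt hr) (Real.exp_pos _).le
  have htend : Tendsto (fun r : ℝ => -rexp (-r ^ 2 / 2)) atTop (nhds (-0)) := by
    refine Tendsto.neg ?_
    refine Real.tendsto_exp_atBot.comp ?_
    have h : Tendsto (fun r : ℝ => r ^ 2 / 2) atTop atTop :=
      (tendsto_pow_atTop two_ne_zero).atTop_div_const (by norm_num)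
    have h' := tendsto_neg_atTop_atBot.comp h
    refine h'.congr fun r => ?_
    simp only [Function.comp_apply, neg_div]
  have hint := integral_Ioi_of_hasDerivAt_of_nonneg' hderiv hpos htend
  have hI : IntegrableOn (fun r : ℝ => r * rexp (-r ^ 2 / 2)) (Ioi 0) :=
    integrableOn_Ioi_deriv_of_nonneg' hderiv hpos htend
  rw [← ofReal_integral_eq_lintegral_ofReal hI ((ae_restrict_iff' measurableSet_Ioi).2
    (ae_of_all _ hpos)), hint]
  norm_num

/-- The image of `(0, π)` under `cos` is `(-1, 1)`. [folklore] -/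
theorem cos_image_Ioo : Real.cos '' Ioo 0 π = Ioo (-1 : ℝ) 1 := by
  apply Set.Subset.antisymm
  · rintro _ ⟨α, ⟨h0, hπ⟩, rfl⟩
    refine ⟨?_, ?_⟩
    · have := Real.strictAntiOn_cos ⟨h0.le, hπ.le⟩ ⟨Real.pi_pos.le, le_rfl⟩ hπ
      rwa [Real.cos_pi] at this
    · have := Real.strictAntiOn_cos ⟨le_rfl, Real.pi_pos.le⟩ ⟨h0.le, hπ.le⟩ h0
      rwa [Real.cos_zero] at this
  · rintro t ⟨h1, h2⟩
    refine ⟨Real.arccos t, ⟨Real.arccos_pos.2 h2, ?_⟩, Real.cos_arccos h1.le h2.le⟩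
    exact Real.arccos_lt_pi.2 h1

/-- **The substitution `t = cos α`**: `∫_{(0,π)} sin α · G(cos α) dα = ∫_{[-1,1]} G(t) dt` for
measurable `G ≥ 0`. [folklore] -/
theorem setLIntegral_sin_mul_comp_cos (G : ℝ → ℝ≥0∞) :
    ∫⁻ α in Ioo (0 : ℝ) π, ENNReal.ofReal (Real.sin α) * G (Real.cos α) =
      ∫⁻ t in Icc (-1 : ℝ) 1, G t := by
  have hderiv : ∀ α ∈ Ioo (0 : ℝ) π, HasDerivWithinAt Real.cos (-Real.sin α) (Ioo (0 : ℝ) π) α :=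
    fun α _ => (Real.hasDerivAt_cos α).hasDerivWithinAt
  have hinj : InjOn Real.cos (Ioo (0 : ℝ) π) := Real.injOn_cos.mono Ioo_subset_Icc_self
  have h := lintegral_image_eq_lintegral_abs_deriv_mul measurableSet_Ioo hderiv hinj G
  rw [cos_image_Ioo, Measure.restrict_congr_set Ioo_ae_eq_Icc] at h
  rw [h]
  refine setLIntegral_congr_fun measurableSet_Ioo fun α hα => ?_
  rw [abs_neg, abs_of_pos (Real.sin_pos_of_pos_of_lt_pi hα.1 hα.2)]

/-- The polar-coordinate form of the integrand of `radialArchimedes`: for `ρ > 0` and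
`α ∈ (-π, π)`, the point `(x, r) = (ρ cos α, ρ sin α)` lies in the upper half-plane iff
`α ∈ (0, π)`, where `x/√(x² + r²) = cos α` and
`ρ · φ(x) · r e^{-r²/2} = (√(2π))⁻¹ ρ² sin α e^{-ρ²/2}`. [folklore] -/
theorem radial_integrand_polar (G : ℝ → ℝ≥0∞) {ρ α : ℝ} (hρ : 0 < ρ) (hα : α ∈ Ioo (-π) π) :
    ENNReal.ofReal ρ * (univ ×ˢ Ioi (0 : ℝ)).indicator
        (fun p : ℝ × ℝ => gaussianPDF 0 1 p.1 *
          (ENNReal.ofReal (p.2 * rexp (-p.2 ^ 2 / 2)) * G (p.1 / √(p.1 ^ 2 + p.2 ^ 2))))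
        (ρ * Real.cos α, ρ * Real.sin α) =
      (Ioo (0 : ℝ) π).indicator (fun α => ENNReal.ofReal ((√(2 * π))⁻¹ * ρ ^ 2 * rexp (-ρ ^ 2 / 2)) *
        (ENNReal.ofReal (Real.sin α) * G (Real.cos α))) α := by
  have hmem : ((ρ * Real.cos α, ρ * Real.sin α) ∈ univ ×ˢ Ioi (0 : ℝ)) ↔ α ∈ Ioo (0 : ℝ) π := by
    simp only [mem_prod, mem_univ, true_and, mem_Ioi, mem_Ioo]
    rw [mul_pos_iff_of_pos_left hρ]
    constructor
    · intro hs
      refine ⟨?_, hα.2⟩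
      by_contra hle
      exact absurd hs (not_lt.2 (Real.sin_nonpos_of_nonpos_of_neg_pi_le (not_lt.1 hle) hα.1.le))
    · exact fun h => Real.sin_pos_of_pos_of_lt_pi h.1 h.2
  by_cases hin : α ∈ Ioo (0 : ℝ) π
  · rw [indicator_of_mem (hmem.2 hin), indicator_of_mem hin]
    have hρ2 : √((ρ * Real.cos α) ^ 2 + (ρ * Real.sin α) ^ 2) = ρ := by
      rw [mul_pow, mul_pow, ← mul_add, Real.cos_sq_add_sin_sq, mul_one, Real.sqrt_sq hρ.le]
    have hsin : 0 < Real.sin α := Real.sin_pos_of_pos_of_lt_pi hin.1 hin.2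
    have he : rexp (-(ρ * Real.cos α) ^ 2 / 2) * rexp (-(ρ * Real.sin α) ^ 2 / 2) =
        rexp (-ρ ^ 2 / 2) := by
      rw [← Real.exp_add]
      congr 1
      have := Real.cos_sq_add_sin_sq α
      rw [mul_pow, mul_pow]
      nlinarith [this]
    have key : ENNReal.ofReal ρ * (gaussianPDF 0 1 (ρ * Real.cos α) *
        ENNReal.ofReal (ρ * Real.sin α * rexp (-(ρ * Real.sin α) ^ 2 / 2))) =
        ENNReal.ofReal ((√(2 * π))⁻¹ * ρ ^ 2 * rexp (-ρ ^ 2 / 2)) * ENNReal.ofReal (Real.sin α) := by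
      rw [gaussianPDF, ← ENNReal.ofReal_mul (gaussianPDFReal_nonneg _ _ _),
        ← ENNReal.ofReal_mul hρ.le, ← ENNReal.ofReal_mul (by positivity)]
      congr 1
      simp only [gaussianPDFReal, NNReal.coe_one, mul_one, sub_zero]
      calc ρ * ((√(2 * π))⁻¹ * rexp (-(ρ * Real.cos α) ^ 2 / 2) *
            (ρ * Real.sin α * rexp (-(ρ * Real.sin α) ^ 2 / 2)))
          = (√(2 * π))⁻¹ * ρ ^ 2 * (rexp (-(ρ * Real.cos α) ^ 2 / 2) *
              rexp (-(ρ * Real.sin α) ^ 2 / 2)) * Real.sin α := by ring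
        _ = (√(2 * π))⁻¹ * ρ ^ 2 * rexp (-ρ ^ 2 / 2) * Real.sin α := by rw [he]
    simp only []
    rw [hρ2, mul_div_cancel_left₀ _ hρ.ne']
    calc ENNReal.ofReal ρ * (gaussianPDF 0 1 (ρ * Real.cos α) *
          (ENNReal.ofReal (ρ * Real.sin α * rexp (-(ρ * Real.sin α) ^ 2 / 2)) * G (Real.cos α)))
        = ENNReal.ofReal ρ * (gaussianPDF 0 1 (ρ * Real.cos α) *
            ENNReal.ofReal (ρ * Real.sin α * rexp (-(ρ * Real.sin α) ^ 2 / 2))) * G (Real.cos α) := by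
          ring
      _ = ENNReal.ofReal ((√(2 * π))⁻¹ * ρ ^ 2 * rexp (-ρ ^ 2 / 2)) * ENNReal.ofReal (Real.sin α) *
            G (Real.cos α) := by rw [key]
      _ = ENNReal.ofReal ((√(2 * π))⁻¹ * ρ ^ 2 * rexp (-ρ ^ 2 / 2)) *
            (ENNReal.ofReal (Real.sin α) * G (Real.cos α)) := by ring
  · rw [indicator_of_notMem (fun h => hin (hmem.1 h)), indicator_of_notMem hin, mul_zero]

/-- The chain of `radialArchimedes` with the radial constant left symbolic:
`LHS(G) = (∫_0^∞ (√(2π))⁻¹ ρ² e^{-ρ²/2} dρ) · ∫_{[-1,1]} G`. [folklore] -/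
theorem radial_chain (G : ℝ → ℝ≥0∞) (hG : Measurable G) :
    ∫⁻ x, (∫⁻ r in Ioi (0 : ℝ), ENNReal.ofReal (r * rexp (-r ^ 2 / 2)) *
        G (x / √(x ^ 2 + r ^ 2))) ∂(gaussianReal 0 1) =
      (∫⁻ ρ in Ioi (0 : ℝ), ENNReal.ofReal ((√(2 * π))⁻¹ * ρ ^ 2 * rexp (-ρ ^ 2 / 2))) *
        ∫⁻ t in Icc (-1 : ℝ) 1, G t := by
  obtain ⟨g, hg⟩ : ∃ g : ℝ × ℝ → ℝ≥0∞, ∀ p, g p = gaussianPDF 0 1 p.1 *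
      (ENNReal.ofReal (p.2 * rexp (-p.2 ^ 2 / 2)) * G (p.1 / √(p.1 ^ 2 + p.2 ^ 2))) :=
    ⟨_, fun _ => rfl⟩
  have hgfun : g = fun p => gaussianPDF 0 1 p.1 *
      (ENNReal.ofReal (p.2 * rexp (-p.2 ^ 2 / 2)) * G (p.1 / √(p.1 ^ 2 + p.2 ^ 2))) := funext hg
  have hφ : Measurable (gaussianPDF 0 1) := measurable_gaussianPDF 0 1
  have hinner : Measurable fun p : ℝ × ℝ =>
      ENNReal.ofReal (p.2 * rexp (-p.2 ^ 2 / 2)) * G (p.1 / √(p.1 ^ 2 + p.2 ^ 2)) :=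
    (ENNReal.measurable_ofReal.comp (by fun_prop)).mul (hG.comp (by fun_prop))
  have hgm : Measurable g := by rw [hgfun]; exact (hφ.comp measurable_fst).mul hinner
  have hps : Measurable fun p : ℝ × ℝ => polarCoord.symm p := by
    have : (fun p : ℝ × ℝ => polarCoord.symm p) = fun p => (p.1 * cos p.2, p.1 * sin p.2) :=
      funext fun p => polarCoord_symm_apply p
    rw [this]
    fun_prop
  -- (R1) the left side as a plane integral of `g` over the upper half-plane
  have hIm : Measurable fun x : ℝ => ∫⁻ r in Ioi (0 : ℝ), ENNReal.ofReal (r * rexp (-r ^ 2 / 2)) *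
      G (x / √(x ^ 2 + r ^ 2)) := hinner.lintegral_prod_right'
  have hR1 : ∫⁻ x, (∫⁻ r in Ioi (0 : ℝ), ENNReal.ofReal (r * rexp (-r ^ 2 / 2)) *
        G (x / √(x ^ 2 + r ^ 2))) ∂(gaussianReal 0 1) =
      ∫⁻ p, (univ ×ˢ Ioi (0 : ℝ)).indicator g p := by
    rw [gaussianReal_of_var_ne_zero 0 one_ne_zero, lintegral_withDensity_eq_lintegral_mul _ hφ hIm,
      lintegral_indicator (MeasurableSet.univ.prod measurableSet_Ioi),
      Measure.volume_eq_prod, ← Measure.prod_restrict, Measure.restrict_univ,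
      lintegral_prod _ hgm.aemeasurable]
    refine lintegral_congr fun x => ?_
    have hmx : Measurable fun r : ℝ => ENNReal.ofReal (r * rexp (-r ^ 2 / 2)) *
        G (x / √(x ^ 2 + r ^ 2)) := hinner.comp (measurable_const.prodMk measurable_id)
    rw [Pi.mul_apply, ← lintegral_const_mul _ hmx]
    exact setLIntegral_congr_fun measurableSet_Ioi fun r _ => (hg (x, r)).symm
  -- (R2)+(R3) polar coordinates and separation of variables
  have hA : Measurable fun α : ℝ => ENNReal.ofReal (Real.sin α) * G (Real.cos α) :=
    (ENNReal.measurable_ofReal.comp Real.measurable_sin).mul (hG.comp Real.measurable_cos)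
  have hW : Measurable fun ρ : ℝ => ENNReal.ofReal ((√(2 * π))⁻¹ * ρ ^ 2 * rexp (-ρ ^ 2 / 2)) :=
    ENNReal.measurable_ofReal.comp (by fun_prop)
  have hmeas : Measurable fun p : ℝ × ℝ =>
      ENNReal.ofReal p.1 • (univ ×ˢ Ioi (0 : ℝ)).indicator g (polarCoord.symm p) :=
    (ENNReal.measurable_ofReal.comp measurable_fst).smul
      ((hgm.indicator (MeasurableSet.univ.prod measurableSet_Ioi)).comp hps)
  rw [hR1, ← lintegral_comp_polarCoord_symm, polarCoord_target, Measure.volume_eq_prod,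
    ← Measure.prod_restrict, lintegral_prod _ hmeas.aemeasurable]
  have hstep : ∀ ρ ∈ Ioi (0 : ℝ), ∫⁻ α in Ioo (-π) π, ENNReal.ofReal (ρ, α).1 •
      (univ ×ˢ Ioi (0 : ℝ)).indicator g (polarCoord.symm (ρ, α)) =
      ENNReal.ofReal ((√(2 * π))⁻¹ * ρ ^ 2 * rexp (-ρ ^ 2 / 2)) *
        ∫⁻ α in Ioo (0 : ℝ) π, ENNReal.ofReal (Real.sin α) * G (Real.cos α) := by
    intro ρ hρ
    have hcongr : ∫⁻ α in Ioo (-π) π, ENNReal.ofReal (ρ, α).1 •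
        (univ ×ˢ Ioi (0 : ℝ)).indicator g (polarCoord.symm (ρ, α)) =
        ∫⁻ α in Ioo (-π) π, (Ioo (0 : ℝ) π).indicator (fun α =>
          ENNReal.ofReal ((√(2 * π))⁻¹ * ρ ^ 2 * rexp (-ρ ^ 2 / 2)) *
            (ENNReal.ofReal (Real.sin α) * G (Real.cos α))) α := by
      refine setLIntegral_congr_fun measurableSet_Ioo fun α hα => ?_
      rw [polarCoord_symm_apply, smul_eq_mul, hgfun]
      exact radial_integrand_polar G hρ hα
    rw [hcongr, lintegral_indicator measurableSet_Ioo, Measure.restrict_restrict measurableSet_Ioo,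
      Set.inter_eq_left.2 (Ioo_subset_Ioo (neg_nonpos.2 Real.pi_pos.le) le_rfl),
      lintegral_const_mul _ hA]
  rw [setLIntegral_congr_fun measurableSet_Ioi hstep, lintegral_mul_const _ hW,
    setLIntegral_sin_mul_comp_cos]

/-- **Radial Archimedes.** Under `γ₁(dx) ⊗ r e^{-r²/2} dr` on `ℝ × (0, ∞)` — a standard Gaussian
coordinate and the radius of an independent planar standard Gaussian, i.e. the cylindrical
coordinates of a standard Gaussian vector of `ℝ³` about a fixed axis — the polar cosine
`x/√(x² + r²)` is uniformly distributed on `[-1, 1]`: Archimedes' hat-box theorem. The constant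
`1/2` is read off the total mass. [folklore] -/
theorem radialArchimedes (G : ℝ → ℝ≥0∞) (hG : Measurable G) :
    ∫⁻ x, (∫⁻ r in Set.Ioi (0 : ℝ), ENNReal.ofReal (r * Real.exp (-r ^ 2 / 2)) *
        G (x / Real.sqrt (x ^ 2 + r ^ 2))) ∂(gaussianReal 0 1) =
      2⁻¹ * ∫⁻ t in Set.Icc (-1 : ℝ) 1, G t := by
  rw [radial_chain G hG]
  congr 1
  -- total mass: the chain for `G ≡ 1` reads `1 = C * 2`
  have h1 := radial_chain (fun _ => 1) measurable_const
  simp only [mul_one, lintegral_const, Measure.restrict_apply MeasurableSet.univ, univ_inter,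
    Real.volume_Icc] at h1
  rw [lintegral_Ioi_mul_exp_neg_sq_half, measure_univ, mul_one, one_mul] at h1
  have h2 : ENNReal.ofReal (1 - -1) = 2 := by norm_num
  rw [h2] at h1
  exact ENNReal.eq_inv_of_mul_eq_one_left h1.symm

/-- **Registered sub-goal `radialArchimedes_forall`** of crux stmt-AtomisticToContinuum-11854
(line `Sketch`, under `stub_lambertLaw` / `stub_archimedes`): radial Archimedes in term form.
[folklore] -/
theorem radialArchimedes_forall :
    ∀ G : ℝ → ENNReal, Measurable G → ∫⁻ x, (∫⁻ r in Set.Ioi (0:ℝ),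
      ENNReal.ofReal (r * Real.exp (-r ^ 2 / 2)) * G (x / Real.sqrt (x ^ 2 + r ^ 2)))
        ∂(ProbabilityTheory.gaussianReal 0 1) = 2⁻¹ * ∫⁻ t in Set.Icc (-1 : ℝ) 1, G t :=
  radialArchimedes

end Summit.AtomisticToContinuum.HydrodynamicLimit.Theorems.LambertianContactSwapLambertianEulerRadialArchimedes

end
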